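import Literature.Computability.Cryptography.ChenQuantumLWEBornRule

/-!
# Chen's Step 9: the output law is a fixed public distribution (secret / instance independence)

REPRODUCTION / ANALYSIS OF A CLAIMED RESULT UNDER ADJUDICATION (withdrawn): Yilei Chen, *Quantum
Algorithms for Lattice Problems*, IACR ePrint 2024/555, version of 2024-04-18 [ChenQuantumLattice2024],
Step 9 (§3.5.9, pp. 34–38; eq. (40) p. 36, operations (9.e)–(9.h) pp. 37–38, eq. (41) p. 38).  Bundle
`papers/QuantumAdvantage/lwe-quantum-autopsy/` (Part 1, `STEPS.md` §4.4(c): "the output distribution of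
Step 9 as written carries no information about the LWE secret" — so far hand-derived and toy-certified for
two secrets in §4.5 / `numerics/step9_exact/`).  HONEST FRAMING: kernel-checked THEOREMS about the
measurement statistics of a WITHDRAWN algorithm — a precise negative result, NOT summit progress, no
cryptanalytic claim in either direction; quantum lower bounds are out of scope.

The typed Step-9 input (`Shape`, module `ChenQuantumLWESteps`) consists of the public parameters
`n, D, p₁, Q` (Cond. C.3 p. 18) and four integer vectors: the short vector `b = (−1, 2p₁p₂, …, 2p₁p_κ,
2p₁s[κ..ℓ], 2p₁e)` of eq. (12) p. 17 — it CONTAINS the LWE secret `s` and error `e`, only its divisibility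
pattern is known —, the offset `v′ = k′x − v` of eq. (35) p. 31 (fixed by the measurements of Steps 1–7),
and the derived `b*`, `v*` of eq. (39)–(40) p. 36.  THEOREM (`Shape.born_weight_eq`): for every ADMISSIBLE
shape and EVERY kernel `K` on coordinate `0` (any replacement of (9.e)–(9.g), any measurement branch;
composed with the coordinate-`0` part of the final `QFT` (9.h) as `Shape.fourierKernel K`), the
unnormalised Born weight of the final outcome `u = (u₀ | u′) ∈ ℤ_N^{n+1}` is

  `‖QFT (processed K) (u₀ | u′)‖² = headWeight D p₁ Q K u₀ · Q`,

where `headWeight D p₁ Q K u₀ = ‖Σ_x (Σ_{x₀} e(−x₀u₀/N) K x₀ x) · A(x)‖²` and `A = publicHead D p₁ Q =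
Σ_{k<p₁} e(−ᾱQk²/P) |2D²Qk⟩` (`ᾱ = Nat.gcdB p₁ Q`, `P = p₁Q`, `N = D²P`) are written in the PUBLIC data
`D, p₁, Q` and the chosen `K` alone: none of `b, v′, b*, v*` occurs, and neither does `u′`.  Consequences:
`Shape.born_weight_instance_indep` / `Shape.prob_instance_indep` — two admissible shapes with the same
`n, D, p₁, Q` (two LWE instances with different secrets; two runs with different measurement histories)
have IDENTICAL Born weights and identical normalised output distributions, for every `K`;
`Shape.born_weight_total`, `Shape.prob_outcome_eq`, `Shape.prob_head_eq`, `Shape.prob_tail_given_head` —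
the normalised law is `Pr[u = (u₀ | u′)] = headWeight u₀ / (Nⁿ · Σ_a headWeight a)`: register `0` follows a
fixed public law, `u′ = u[1..n]` is uniform on `ℤ_Nⁿ` given any occurring `u₀`.  So the final measurement of
Step 9 can be sampled classically without access to the instance.  Ingredients (by name): the CRT
certificate `phi8fCertificate` (`ChenQuantumLWEProductProofs`; its coordinate-`0` data read `b*₀`, `v*₀`
only, and admissibility fixes `b*₀ = Q`, `v*₀ = 0`), the flat tail spectrum `phi8fLine_outputWeight` /
`tail_fourier_norm_sq` (`ChenQuantumLWEOutputLaw`), and `Shape.qft_processed_cons` (`ChenQuantumLWEBornRule`).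

Not here: anything about Steps 1–8 (whether an admissible `|φ8.f⟩` is reached at all is Chen's Claims
3.12/3.14, restated — not re-verified — in `STEPS.md` §3); nothing about a specific `K`.
-/

namespace Literature.Computability.Cryptography.Chen2024

open scoped BigOperators

/-! ### The public closed form -/

/-- The coordinate-`0` factor `|A⟩` of `|φ8.f⟩` written in PUBLIC data only:
`A(x) = Σ_{k<p₁} e(−ᾱQk²/P) · [x = 2D²Qk mod N]`, `ᾱ = Nat.gcdB p₁ Q`, `P = p₁Q`, `N = D²P`
(for every admissible shape this is the certificate's `headKet`, `Shape.headKet_eq_publicHead`).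
[cite: ChenQuantumLattice2024, eq. (39)–(40) p. 36] -/
noncomputable def publicHead (D p₁ Q : ℕ+) : ZMod ((D * D * (p₁ * Q) : ℕ+) : ℕ) → ℂ :=
  fun x => ∑ k ∈ Finset.range (p₁ : ℕ),
    if x = ((2 * (D : ℤ) ^ 2 * (k : ℤ) * (Q : ℤ) : ℤ) : ZMod ((D * D * (p₁ * Q) : ℕ+) : ℕ)) then
      e (((((-((Nat.gcdB p₁ Q : ℤ) * (Q : ℤ) * (k : ℤ) ^ 2) : ℤ) : ZMod ((p₁ * Q : ℕ+) : ℕ))).val : ℚ)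
          / ((p₁ * Q : ℕ+) : ℕ))
    else 0

/-- The Born weight of register `0` written in PUBLIC data and the chosen kernel `K` only:
`headWeight D p₁ Q K u₀ = ‖Σ_x (Σ_{x₀} e(−x₀u₀/N) K x₀ x) · A(x)‖²` (`A = publicHead D p₁ Q`; the inner sum
is `K` composed with the coordinate-`0` Fourier kernel of the final `QFT`, cf. `Shape.fourierKernel`).
[cite: ChenQuantumLattice2024, Lemma 2.12 p. 12; §3.5.9 (9.e)–(9.h) pp. 37–38] -/
noncomputable def headWeight (D p₁ Q : ℕ+)
    (K : ZMod ((D * D * (p₁ * Q) : ℕ+) : ℕ) → ZMod ((D * D * (p₁ * Q) : ℕ+) : ℕ) → ℂ)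
    (u₀ : ZMod ((D * D * (p₁ * Q) : ℕ+) : ℕ)) : ℝ :=
  ‖∑ x : ZMod ((D * D * (p₁ * Q) : ℕ+) : ℕ),
      (∑ x₀ : ZMod ((D * D * (p₁ * Q) : ℕ+) : ℕ),
          e (-(((x₀.val * u₀.val : ℕ) : ℚ) / ((D * D * (p₁ * Q) : ℕ+) : ℕ))) * K x₀ x)
        * publicHead D p₁ Q x‖ ^ 2

namespace Shape

variable (S : Shape)

/-- For an admissible shape the certificate's coordinate-`0` line is `k ↦ 2D²Qk` (`b*₀ = Q`, `v*₀ = 0`).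
[cite: ChenQuantumLattice2024, eq. (39)–(40) p. 36] -/
theorem cert_A (h : S.Admissible) (k : ℕ) :
    h.cert.A k = ((2 * (S.D : ℤ) ^ 2 * (k : ℤ) * (S.Q : ℤ) : ℤ) : ZMod S.N) := by
  show (((2 * (S.D : ℤ) ^ 2 * ((k : ℕ) : ℤ) * S.bstar 0 + S.vstar 0 : ℤ)) : ZMod S.N) = _
  rw [h.bstar_head, h.vstar_head, add_zero]

/-- `|A⟩` of an admissible shape IS `publicHead D p₁ Q` — the LWE instance does not enter the coordinate-`0`
factor. [cite: ChenQuantumLattice2024, eq. (39)–(40) p. 36] -/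
theorem headKet_eq_publicHead (h : S.Admissible) (x : ZMod S.N) :
    h.cert.headKet x = publicHead S.D S.p₁ S.Q x := by
  simp only [Certificate.headKet, publicHead]
  refine Finset.sum_congr rfl fun k _ => ?_
  rw [S.cert_A h k]
  rfl

/-- The Born weight of `(u₀ | u′)` with the certificate's head factor: `‖Σ_x (fourierKernel K) u₀ x · A(x)‖² · Q`.
[cite: ChenQuantumLattice2024, §3.5.9 (9.e)–(9.h) pp. 37–38] -/
theorem born_weight_eq_cert (h : S.Admissible) (K : ZMod S.N → ZMod S.N → ℂ) (u₀ : ZMod S.N)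
    (u' : Fin S.n → ZMod S.N) :
    ‖qft (S.processed K) (Fin.cons u₀ u')‖ ^ 2
      = ‖∑ x, S.fourierKernel K u₀ x * h.cert.headKet x‖ ^ 2 * S.Q := by
  rw [S.qft_processed_cons K u₀ u', S.phi8f_eq_ket]
  exact phi8fLine_outputWeight S.n S.D S.p₁ S.Q S.bstar S.vstar h.cop_pQ (by rw [h.bstar_head])
    h.bstar_tail h.odd_Q (S.fourierKernel K) u₀ u'

/-- **The output law of Step 9 in closed PUBLIC form.**  For every admissible shape and every kernel `K` on
coordinate `0`: `‖QFT (processed K) (u₀ | u′)‖² = headWeight D p₁ Q K u₀ · Q` — a function of the public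
parameters, `K` and `u₀` only; the vectors `b` (which carries the LWE secret and error, eq. (12)), `v′`, `b*`,
`v*` and the tail outcome `u′` do not occur. [cite: ChenQuantumLattice2024, §3.5.9 pp. 34–38, eq. (12) p. 17] -/
theorem born_weight_eq (h : S.Admissible) (K : ZMod S.N → ZMod S.N → ℂ) (u₀ : ZMod S.N)
    (u' : Fin S.n → ZMod S.N) :
    ‖qft (S.processed K) (Fin.cons u₀ u')‖ ^ 2 = headWeight S.D S.p₁ S.Q K u₀ * S.Q := by
  rw [S.born_weight_eq_cert h K u₀ u']
  simp_rw [S.headKet_eq_publicHead h]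
  rfl

/-- **Total weight of a branch in public form**: `Σ_u ‖QFT (processed K) u‖² = Nⁿ · Q · Σ_{u₀} headWeight u₀`.
[cite: ChenQuantumLattice2024, Lemma 2.12 p. 12; §3.5.9 (9.h) p. 38] -/
theorem born_weight_total (h : S.Admissible) (K : ZMod S.N → ZMod S.N → ℂ) :
    ∑ u, ‖qft (S.processed K) u‖ ^ 2
      = ((S.N : ℕ) : ℝ) ^ S.n * S.Q * ∑ u₀, headWeight S.D S.p₁ S.Q K u₀ := by
  rw [S.sum_cons]
  simp_rw [S.born_weight_eq h K, Finset.sum_const, Finset.card_univ, Fintype.card_fun, ZMod.card,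
    Fintype.card_fin, nsmul_eq_mul, Nat.cast_pow, Finset.mul_sum]
  exact Finset.sum_congr rfl fun u₀ _ => by ring

/-- **Normalised output law (Born rule), public and explicit**: for every admissible shape and every `K`,
`Pr[u = (u₀ | u′)] = headWeight u₀ / (Nⁿ · Σ_a headWeight a)` (both sides `0` on a branch that does not
occur). [cite: ChenQuantumLattice2024, §3.5.9 (9.h) p. 38] -/
theorem prob_outcome_eq (h : S.Admissible) (K : ZMod S.N → ZMod S.N → ℂ) (u₀ : ZMod S.N)
    (u' : Fin S.n → ZMod S.N) :
    ‖qft (S.processed K) (Fin.cons u₀ u')‖ ^ 2 / ∑ u, ‖qft (S.processed K) u‖ ^ 2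
      = headWeight S.D S.p₁ S.Q K u₀
          / (((S.N : ℕ) : ℝ) ^ S.n * ∑ a, headWeight S.D S.p₁ S.Q K a) := by
  rw [S.born_weight_eq h K u₀ u', S.born_weight_total h K]
  have hQ : ((S.Q : ℕ) : ℝ) ≠ 0 := by exact_mod_cast S.Q.ne_zero
  rw [show ((S.N : ℕ) : ℝ) ^ S.n * S.Q * ∑ a, headWeight S.D S.p₁ S.Q K a
      = (((S.N : ℕ) : ℝ) ^ S.n * ∑ a, headWeight S.D S.p₁ S.Q K a) * S.Q by ring]
  exact mul_div_mul_right _ _ hQ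

/-- **Register `0` follows a fixed public law**: `Pr[u₀ = a] = headWeight a / Σ_a' headWeight a'`.
[cite: ChenQuantumLattice2024, §3.5.9 (9.h) p. 38] -/
theorem prob_head_eq (h : S.Admissible) (K : ZMod S.N → ZMod S.N → ℂ) (u₀ : ZMod S.N) :
    (∑ u' : Fin S.n → ZMod S.N, ‖qft (S.processed K) (Fin.cons u₀ u')‖ ^ 2)
        / ∑ u, ‖qft (S.processed K) u‖ ^ 2
      = headWeight S.D S.p₁ S.Q K u₀ / ∑ a, headWeight S.D S.p₁ S.Q K a := by
  simp_rw [S.born_weight_eq h K u₀, Finset.sum_const, Finset.card_univ, Fintype.card_fun, ZMod.card,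
    Fintype.card_fin, nsmul_eq_mul, Nat.cast_pow]
  rw [S.born_weight_total h K, mul_comm (headWeight S.D S.p₁ S.Q K u₀) _, ← mul_assoc]
  have hN : (0 : ℝ) < ((S.N : ℕ) : ℝ) := by exact_mod_cast S.N.pos
  have hQ : (0 : ℝ) < ((S.Q : ℕ) : ℝ) := by exact_mod_cast S.Q.pos
  exact mul_div_mul_left _ _ (mul_ne_zero (pow_ne_zero _ hN.ne') hQ.ne')

/-- **`u′ = u[1..n]` is uniform on `ℤ_Nⁿ` given any occurring `u₀`**: `Pr[u′ = c | u₀] = 1/Nⁿ`.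
[cite: ChenQuantumLattice2024, §3.5.9 (9.h) p. 38, eq. (41)] -/
theorem prob_tail_given_head (h : S.Admissible) (K : ZMod S.N → ZMod S.N → ℂ) (u₀ : ZMod S.N)
    (u' : Fin S.n → ZMod S.N) (hu₀ : headWeight S.D S.p₁ S.Q K u₀ ≠ 0) :
    ‖qft (S.processed K) (Fin.cons u₀ u')‖ ^ 2
        / ∑ v' : Fin S.n → ZMod S.N, ‖qft (S.processed K) (Fin.cons u₀ v')‖ ^ 2
      = 1 / ((S.N : ℕ) : ℝ) ^ S.n := by
  simp_rw [S.born_weight_eq h K u₀, Finset.sum_const, Finset.card_univ, Fintype.card_fun, ZMod.card,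
    Fintype.card_fin, nsmul_eq_mul, Nat.cast_pow]
  have hQ : ((S.Q : ℕ) : ℝ) ≠ 0 := by exact_mod_cast S.Q.ne_zero
  rw [div_mul_cancel_right₀ (mul_ne_zero hu₀ hQ), one_div]

/-! ### Two instances, one law -/

/-- The same public parameters `n, D, p₁, Q` with other vectors `b, v′, b*, v*` — e.g. another LWE instance
(other secret `s` and error `e` inside `b`, eq. (12)) and another measurement history (`v′ = k′x − v`, eq. (35)).
[cite: ChenQuantumLattice2024, eq. (12) p. 17, eq. (35) p. 31, eq. (39) p. 36] -/
abbrev withVectors (b₂ v₂ c₂ w₂ : Fin (S.n + 1) → ℤ) : Shape :=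
  { S with b := b₂, v' := v₂, bstar := c₂, vstar := w₂ }

/-- **Instance independence of every Born weight.**  For two admissible shapes with the same public
parameters and every kernel `K` on coordinate `0`, every outcome `u ∈ ℤ_N^{n+1}` of the final measurement has
the same weight: the statistics of Step 9 carry no information about `b` (the LWE secret), `v′`, `b*`, `v*`.
[cite: ChenQuantumLattice2024, §3.5.9 pp. 34–38, eq. (12) p. 17] -/
theorem born_weight_instance_indep (h : S.Admissible) {b₂ v₂ c₂ w₂ : Fin (S.n + 1) → ℤ}
    (h₂ : (S.withVectors b₂ v₂ c₂ w₂).Admissible) (K : ZMod S.N → ZMod S.N → ℂ)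
    (u : Fin (S.n + 1) → ZMod S.N) :
    ‖qft ((S.withVectors b₂ v₂ c₂ w₂).processed K) u‖ ^ 2 = ‖qft (S.processed K) u‖ ^ 2 := by
  have e1 : ‖qft ((S.withVectors b₂ v₂ c₂ w₂).processed K)
        (Fin.cons (u 0) (Fin.tail u) : Fin (S.n + 1) → ZMod S.N)‖ ^ 2
      = headWeight S.D S.p₁ S.Q K (u 0) * S.Q :=
    born_weight_eq _ h₂ K (u 0) (Fin.tail u)
  rw [Fin.cons_self_tail] at e1
  rw [e1, ← S.born_weight_eq h K (u 0) (Fin.tail u), Fin.cons_self_tail]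

/-- **Instance independence of the normalised output distribution** (every `K`, every outcome).
[cite: ChenQuantumLattice2024, §3.5.9 pp. 34–38, eq. (12) p. 17] -/
theorem prob_instance_indep (h : S.Admissible) {b₂ v₂ c₂ w₂ : Fin (S.n + 1) → ℤ}
    (h₂ : (S.withVectors b₂ v₂ c₂ w₂).Admissible) (K : ZMod S.N → ZMod S.N → ℂ)
    (u : Fin (S.n + 1) → ZMod S.N) :
    ‖qft ((S.withVectors b₂ v₂ c₂ w₂).processed K) u‖ ^ 2
        / ∑ v : Fin (S.n + 1) → ZMod S.N, ‖qft ((S.withVectors b₂ v₂ c₂ w₂).processed K) v‖ ^ 2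
      = ‖qft (S.processed K) u‖ ^ 2 / ∑ v, ‖qft (S.processed K) v‖ ^ 2 := by
  simp_rw [S.born_weight_instance_indep h h₂ K]

end Shape

end Literature.Computability.Cryptography.Chen2024
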